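import Mathlib.Analysis.Complex.Harmonic.Analytic
import Mathlib.Analysis.InnerProductSpace.Harmonic.Constructions
import Mathlib.Analysis.SpecialFunctions.Pow.Real
import Literature.Analysis.Complex.HarnackHalfPlane
import Literature.Analysis.Complex.UnivalentSequenceLimits
import Literature.Analysis.Complex.LocalCrossTheorem
import HarnessLib

/-!
# The sharp Harnack chord of the right half-plane

For a non-negative harmonic function `v` on the open right half-plane `H = {Re z > 0}` the quotient
`v(x)/x` is non-increasing along the positive real axis:
`(x₁/x₂)·v(x₂) ≤ v(x₁)` for `0 < x₁ ≤ x₂` (`harnack_chord_halfPlane`). This is Harnack's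
inequality with the SHARP constant: by the Herglotz representation
`v(x) = cx + π⁻¹∫ x dν(s)/(x² + s²)`; here it is obtained from the disc Harnack inequality of the
tree (`Complex.im_apply_ge_harnack`, Conway, *Functions of One Complex Variable I*, Ch. X §2) by the
Cayley map `w ↦ x₂(1 + w)/(1 − w)` of the unit disc onto `H` (tree `cayleyInv_re_pos`), under which the disc constant
`(1 − ρ)/(1 + ρ)` at `ρ = (x₂ − x₁)/(x₁ + x₂)` is exactly `x₁/x₂`.

Corollaries: the multiplicative ("two-constants") form for zero-free bounded holomorphic functions,
`‖F(x₁)‖ ≤ ‖F(x₂)‖^{x₁/x₂}` when `‖F‖ ≤ 1` on `H` (`norm_le_norm_rpow_of_zeroFree_halfPlane`, via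
harmonicity of `log ‖F‖`, Mathlib `AnalyticAt.harmonicAt_log_norm`), and with a general bound `M`,
`‖F(x₁)‖ ≤ M^{1 − x₁/x₂} ‖F(x₂)‖^{x₁/x₂}` (`norm_le_two_constants_halfPlane`).

Not here: the Herglotz–Riesz representation itself, the sector version (Phragmén–Lindelöf exponent
`π/(2α)`), boundary behaviour.
-/

noncomputable section

open Complex Metric Set InnerProductSpace

namespace Literature.Analysis.Complex

/-- **The sharp Harnack chord of the right half-plane.** A non-negative harmonic function `v` on
`{Re z > 0}` satisfies `(x₁/x₂)·v(x₂) ≤ v(x₁)` for `0 < x₁ ≤ x₂`: disc Harnack with the sharp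
constant, transported by the Cayley map `w ↦ x₂(1+w)/(1-w)` (`ψ 0 = x₂`, `ψ(-ρ) = x₁`,
`(1-ρ)/(1+ρ) = x₁/x₂`). [cite: Conway1978, Ch. X §2] -/
theorem harnack_chord_halfPlane {v : ℂ → ℝ} (hv : HarmonicOnNhd v {z : ℂ | 0 < z.re})
    (hv0 : ∀ z : ℂ, 0 < z.re → 0 ≤ v z) {x₁ x₂ : ℝ} (hx₁ : 0 < x₁) (hx₁₂ : x₁ ≤ x₂) :
    x₁ / x₂ * v x₂ ≤ v x₁ := by
  have hx₂ : 0 < x₂ := lt_of_lt_of_le hx₁ hx₁₂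
  have hs : 0 < x₁ + x₂ := by positivity
  -- the Cayley map of the disc into the right half-plane, normalised by `ψ 0 = x₂`
  set ψ : ℂ → ℂ := fun w ↦ (x₂ : ℂ) * ((1 + w) / (1 - w)) with hψ
  have hne : ∀ w ∈ ball (0 : ℂ) 1, (1 : ℂ) - w ≠ 0 := by
    intro w hw h
    rw [mem_ball_zero_iff] at hw
    rw [sub_eq_zero] at h
    rw [← h] at hw
    simp at hw
  have hψd : DifferentiableOn ℂ ψ (ball 0 1) := by
    intro w hw
    have h1 : DifferentiableAt ℂ (fun w : ℂ ↦ (1 + w) / (1 - w)) w :=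
      ((differentiableAt_const _).add differentiableAt_id).div
        ((differentiableAt_const _).sub differentiableAt_id) (hne w hw)
    exact (h1.const_mul (x₂ : ℂ)).differentiableWithinAt
  have hψre : ∀ w ∈ ball (0 : ℂ) 1, 0 < (ψ w).re := by
    intro w hw
    show 0 < ((x₂ : ℂ) * ((1 + w) / (1 - w))).re
    rw [re_ofReal_mul]
    exact mul_pos hx₂ (cayleyInv_re_pos (mem_ball_zero_iff.1 hw))
  have hmaps : MapsTo ψ (ball 0 1) {z : ℂ | 0 < z.re} := fun w hw ↦ hψre w hw
  have hopen : IsOpen {z : ℂ | 0 < z.re} := isOpen_lt continuous_const Complex.continuous_re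
  -- `v ∘ ψ` is harmonic on the disc, hence the real part of a holomorphic `F`
  have hu : HarmonicOnNhd (fun w ↦ v (ψ w)) (ball 0 1) :=
    harmonicOnNhd_comp_of_differentiableOn hv hopen hψd isOpen_ball hmaps
  obtain ⟨F, hFa, hFre⟩ := hu.exists_analyticOnNhd_ball_re_eq
  -- the two points: `ψ 0 = x₂` and `ψ (-ρ) = x₁`, `ρ = (x₂ - x₁)/(x₁ + x₂) ∈ [0,1)`
  set ρ : ℝ := (x₂ - x₁) / (x₁ + x₂) with hρ
  have hρ0 : 0 ≤ ρ := div_nonneg (by linarith) hs.le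
  have hρ1 : ρ < 1 := by rw [hρ, div_lt_one hs]; linarith
  have h1ρ : 1 - ρ = 2 * x₁ / (x₁ + x₂) := by rw [hρ]; field_simp; ring
  have h1ρ' : 1 + ρ = 2 * x₂ / (x₁ + x₂) := by rw [hρ]; field_simp; ring
  have hquot : (1 - ρ) / (1 + ρ) = x₁ / x₂ := by
    rw [h1ρ, h1ρ']
    field_simp
  set w₁ : ℂ := ((-ρ : ℝ) : ℂ) with hw₁
  have hw₁n : ‖w₁‖ = ρ := by
    rw [hw₁, norm_real, Real.norm_eq_abs, abs_neg, abs_of_nonneg hρ0]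
  have hw₁b : w₁ ∈ ball (0 : ℂ) 1 := mem_ball_zero_iff.2 (by rw [hw₁n]; exact hρ1)
  have h0b : (0 : ℂ) ∈ ball (0 : ℂ) 1 := mem_ball_self one_pos
  have hψ0 : ψ 0 = (x₂ : ℂ) := by simp [hψ]
  have hψ1 : ψ w₁ = (x₁ : ℂ) := by
    have h1 : (1 : ℂ) + w₁ = ((2 * x₁ / (x₁ + x₂) : ℝ) : ℂ) := by
      rw [← h1ρ, hw₁]; push_cast; ring
    have h2 : (1 : ℂ) - w₁ = ((2 * x₂ / (x₁ + x₂) : ℝ) : ℂ) := by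
      rw [← h1ρ', hw₁]; push_cast; ring
    show (x₂ : ℂ) * ((1 + w₁) / (1 - w₁)) = (x₁ : ℂ)
    rw [h1, h2]
    norm_cast
    field_simp
  -- Harnack's inequality on the unit disc for `Q = (F + ε) I`, `im Q = v ∘ ψ + ε > 0`
  have hchord : ∀ ε : ℝ, 0 < ε → (v x₂ + ε) * ((1 - ρ) / (1 + ρ)) ≤ v x₁ + ε := by
    intro ε hε
    set Q : ℂ → ℂ := fun w ↦ (F w + ε) * I with hQ
    have hQim : ∀ w ∈ ball (0 : ℂ) 1, (Q w).im = v (ψ w) + ε := by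
      intro w hw
      have e : (F w).re = v (ψ w) := hFre hw
      show ((F w + ε) * I).im = v (ψ w) + ε
      rw [mul_I_im, add_re, ofReal_re, e]
    have hQd : DifferentiableOn ℂ Q (ball 0 1) :=
      (hFa.differentiableOn.add_const _).mul_const _
    have hQpos : ∀ w ∈ ball (0 : ℂ) 1, 0 < (Q w).im := by
      intro w hw
      rw [hQim w hw]
      exact add_pos_of_nonneg_of_pos (hv0 _ (hψre w hw)) hε
    have h := Complex.im_apply_ge_harnack one_pos hQd hQpos hw₁b
    rw [sub_zero, hw₁n, hQim 0 h0b, hQim w₁ hw₁b, hψ0, hψ1] at h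
    exact h
  -- `ε → 0⁺`
  rw [hquot] at hchord
  refine le_of_forall_pos_le_add fun ε hε ↦ ?_
  have h := hchord ε hε
  have h' : (v x₂ + ε) * (x₁ / x₂) = x₁ / x₂ * v x₂ + ε * (x₁ / x₂) := by ring
  have h'' : 0 ≤ ε * (x₁ / x₂) := by positivity
  linarith

/-- **`v(x)/x` is non-increasing** along the positive real axis for a non-negative harmonic `v` on
the right half-plane (the chord inequality, rearranged). [cite: Conway1978, Ch. X §2] -/
theorem antitoneOn_div_of_harmonic_nonneg_halfPlane {v : ℂ → ℝ}
    (hv : HarmonicOnNhd v {z : ℂ | 0 < z.re}) (hv0 : ∀ z : ℂ, 0 < z.re → 0 ≤ v z) :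
    AntitoneOn (fun x : ℝ => v x / x) (Ioi 0) := by
  intro x₁ hx₁ x₂ _ hx₁₂
  have hx₁' : (0 : ℝ) < x₁ := hx₁
  have hx₂' : 0 < x₂ := lt_of_lt_of_le hx₁' hx₁₂
  have h := harnack_chord_halfPlane hv hv0 hx₁' hx₁₂
  show v x₂ / x₂ ≤ v x₁ / x₁
  rw [div_le_div_iff₀ hx₂' hx₁']
  have h2 : x₁ / x₂ * v x₂ * x₂ ≤ v x₁ * x₂ := mul_le_mul_of_nonneg_right h hx₂'.le
  have h3 : x₁ / x₂ * v x₂ * x₂ = v x₂ * x₁ := by field_simp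
  linarith [h3 ▸ h2]

/-- **Multiplicative chord for zero-free holomorphic functions bounded by one.** If `F` is
holomorphic and zero-free on `{Re z > 0}` with `‖F‖ ≤ 1` there, then
`‖F(x₁)‖ ≤ ‖F(x₂)‖^{x₁/x₂}` for `0 < x₁ ≤ x₂` — the chord inequality for the non-negative
harmonic function `-log ‖F‖`. [cite: Conway1978, Ch. X §2] -/
theorem norm_le_norm_rpow_of_zeroFree_halfPlane {F : ℂ → ℂ}
    (hF : DifferentiableOn ℂ F {z : ℂ | 0 < z.re}) (hF0 : ∀ z : ℂ, 0 < z.re → F z ≠ 0)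
    (hF1 : ∀ z : ℂ, 0 < z.re → ‖F z‖ ≤ 1) {x₁ x₂ : ℝ} (hx₁ : 0 < x₁) (hx₁₂ : x₁ ≤ x₂) :
    ‖F x₁‖ ≤ ‖F x₂‖ ^ (x₁ / x₂) := by
  have hx₂ : 0 < x₂ := lt_of_lt_of_le hx₁ hx₁₂
  have hopen : IsOpen {z : ℂ | 0 < z.re} := isOpen_lt continuous_const Complex.continuous_re
  -- `v = -log ‖F‖` is harmonic and non-negative on the half-plane
  set v : ℂ → ℝ := fun z ↦ -Real.log ‖F z‖ with hv
  have hvh : HarmonicOnNhd v {z : ℂ | 0 < z.re} := by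
    intro z hz
    have ha : AnalyticAt ℂ F z := hF.analyticAt (hopen.mem_nhds hz)
    exact (ha.harmonicAt_log_norm (hF0 z hz)).neg
  have hv0 : ∀ z : ℂ, 0 < z.re → 0 ≤ v z := by
    intro z hz
    show 0 ≤ -Real.log ‖F z‖
    have := Real.log_nonpos (norm_nonneg (F z)) (hF1 z hz)
    linarith
  have hch := harnack_chord_halfPlane hvh hv0 hx₁ hx₁₂
  -- unwind the logarithms
  have hx₁re : (0 : ℝ) < ((x₁ : ℝ) : ℂ).re := by simpa using hx₁
  have hx₂re : (0 : ℝ) < ((x₂ : ℝ) : ℂ).re := by simpa using hx₂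
  have hp₁ : 0 < ‖F x₁‖ := norm_pos_iff.2 (hF0 _ hx₁re)
  have hp₂ : 0 < ‖F x₂‖ := norm_pos_iff.2 (hF0 _ hx₂re)
  have hlog : Real.log ‖F x₁‖ ≤ x₁ / x₂ * Real.log ‖F x₂‖ := by
    have h1 : x₁ / x₂ * (-Real.log ‖F x₂‖) ≤ -Real.log ‖F x₁‖ := hch
    linarith
  rw [← Real.log_le_log_iff hp₁ (Real.rpow_pos_of_pos hp₂ _), Real.log_rpow hp₂]
  exact hlog

/-- **Two-constants form.** If `F` is holomorphic and zero-free on `{Re z > 0}` with `‖F‖ ≤ M`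
there, then `‖F(x₁)‖ ≤ M^{1 − x₁/x₂} · ‖F(x₂)‖^{x₁/x₂}` for `0 < x₁ ≤ x₂`. [cite: Conway1978, Ch. X §2] -/
theorem norm_le_two_constants_halfPlane {F : ℂ → ℂ} {M : ℝ}
    (hF : DifferentiableOn ℂ F {z : ℂ | 0 < z.re}) (hF0 : ∀ z : ℂ, 0 < z.re → F z ≠ 0)
    (hFM : ∀ z : ℂ, 0 < z.re → ‖F z‖ ≤ M) {x₁ x₂ : ℝ} (hx₁ : 0 < x₁) (hx₁₂ : x₁ ≤ x₂) :
    ‖F x₁‖ ≤ M ^ (1 - x₁ / x₂) * ‖F x₂‖ ^ (x₁ / x₂) := by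
  have hx₂ : 0 < x₂ := lt_of_lt_of_le hx₁ hx₁₂
  have hx₁re : (0 : ℝ) < ((x₁ : ℝ) : ℂ).re := by simpa using hx₁
  have hM : 0 < M := lt_of_lt_of_le (norm_pos_iff.2 (hF0 _ hx₁re)) (hFM _ hx₁re)
  -- normalise: `G = F / M` is zero-free and bounded by one
  set G : ℂ → ℂ := fun z ↦ F z / M with hG
  have hGd : DifferentiableOn ℂ G {z : ℂ | 0 < z.re} := hF.div_const _
  have hG0 : ∀ z : ℂ, 0 < z.re → G z ≠ 0 := fun z hz ↦
    div_ne_zero (hF0 z hz) (by exact_mod_cast hM.ne')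
  have hG1 : ∀ z : ℂ, 0 < z.re → ‖G z‖ ≤ 1 := by
    intro z hz
    show ‖F z / M‖ ≤ 1
    rw [norm_div, Complex.norm_real, Real.norm_eq_abs, abs_of_pos hM, div_le_one hM]
    exact hFM z hz
  have h := norm_le_norm_rpow_of_zeroFree_halfPlane hGd hG0 hG1 hx₁ hx₁₂
  have hn : ∀ x : ℝ, ‖G x‖ = ‖F x‖ / M := by
    intro x
    show ‖F x / M‖ = ‖F x‖ / M
    rw [norm_div, Complex.norm_real, Real.norm_eq_abs, abs_of_pos hM]
  rw [hn, hn, Real.div_rpow (norm_nonneg _) hM.le, le_div_iff₀ (Real.rpow_pos_of_pos hM _)] at h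
  -- `h : ‖F x₁‖ / M * M^θ ≤ ‖F x₂‖^θ`; clear denominators
  have hMθ : 0 < M ^ (x₁ / x₂) := Real.rpow_pos_of_pos hM _
  have h2 : ‖F x₁‖ * M ^ (x₁ / x₂) ≤ ‖F x₂‖ ^ (x₁ / x₂) * M := by
    have h3 := mul_le_mul_of_nonneg_right h hM.le
    calc ‖F x₁‖ * M ^ (x₁ / x₂) = ‖F x₁‖ / M * M ^ (x₁ / x₂) * M := by field_simp
      _ ≤ ‖F x₂‖ ^ (x₁ / x₂) * M := h3
  rw [Real.rpow_sub hM, Real.rpow_one,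
    show M / M ^ (x₁ / x₂) * ‖F x₂‖ ^ (x₁ / x₂) = ‖F x₂‖ ^ (x₁ / x₂) * M / M ^ (x₁ / x₂) by ring,
    le_div_iff₀ hMθ]
  exact h2

/-- **The reverse sharp chord: `x·v(x)` is non-decreasing.** A non-negative harmonic function
`v` on `{Re z > 0}` satisfies `x₁·v(x₁) ≤ x₂·v(x₂)` for `0 < x₁ ≤ x₂` — the UPPER disc Harnack
bound `u(w) ≤ u(0)(1+|w|)/(1-|w|)` transported by the same Cayley map (`(1+ρ)/(1-ρ) = x₂/x₁`).
Together with `harnack_chord_halfPlane`: `(x₁/x₂)·v(x₁) ≤ v(x₂) ≤ (x₂/x₁)·v(x₁)`, the two-sided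
sharp Harnack inequality of the half-plane along its normal ray (Herglotz: `x·v(x) = cx² +
π⁻¹∫ x² dν(s)/(x² + s²)`, each term non-decreasing). [cite: Conway1978, Ch. X §2] -/
theorem mul_le_mul_of_harmonic_nonneg_halfPlane {v : ℂ → ℝ}
    (hv : HarmonicOnNhd v {z : ℂ | 0 < z.re}) (hv0 : ∀ z : ℂ, 0 < z.re → 0 ≤ v z) {x₁ x₂ : ℝ}
    (hx₁ : 0 < x₁) (hx₁₂ : x₁ ≤ x₂) : x₁ * v x₁ ≤ x₂ * v x₂ := by
  have hx₂ : 0 < x₂ := lt_of_lt_of_le hx₁ hx₁₂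
  have hs : 0 < x₁ + x₂ := by positivity
  -- the Cayley map of the disc into the right half-plane, normalised by `ψ 0 = x₂`
  set ψ : ℂ → ℂ := fun w ↦ (x₂ : ℂ) * ((1 + w) / (1 - w)) with hψ
  have hne : ∀ w ∈ ball (0 : ℂ) 1, (1 : ℂ) - w ≠ 0 := by
    intro w hw h
    rw [mem_ball_zero_iff] at hw
    rw [sub_eq_zero] at h
    rw [← h] at hw
    simp at hw
  have hψd : DifferentiableOn ℂ ψ (ball 0 1) := by
    intro w hw
    have h1 : DifferentiableAt ℂ (fun w : ℂ ↦ (1 + w) / (1 - w)) w :=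
      ((differentiableAt_const _).add differentiableAt_id).div
        ((differentiableAt_const _).sub differentiableAt_id) (hne w hw)
    exact (h1.const_mul (x₂ : ℂ)).differentiableWithinAt
  have hψre : ∀ w ∈ ball (0 : ℂ) 1, 0 < (ψ w).re := by
    intro w hw
    show 0 < ((x₂ : ℂ) * ((1 + w) / (1 - w))).re
    rw [re_ofReal_mul]
    exact mul_pos hx₂ (cayleyInv_re_pos (mem_ball_zero_iff.1 hw))
  have hmaps : MapsTo ψ (ball 0 1) {z : ℂ | 0 < z.re} := fun w hw ↦ hψre w hw
  have hopen : IsOpen {z : ℂ | 0 < z.re} := isOpen_lt continuous_const Complex.continuous_re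
  have hu : HarmonicOnNhd (fun w ↦ v (ψ w)) (ball 0 1) :=
    harmonicOnNhd_comp_of_differentiableOn hv hopen hψd isOpen_ball hmaps
  obtain ⟨F, hFa, hFre⟩ := hu.exists_analyticOnNhd_ball_re_eq
  set ρ : ℝ := (x₂ - x₁) / (x₁ + x₂) with hρ
  have hρ0 : 0 ≤ ρ := div_nonneg (by linarith) hs.le
  have hρ1 : ρ < 1 := by rw [hρ, div_lt_one hs]; linarith
  have h1ρ : 1 - ρ = 2 * x₁ / (x₁ + x₂) := by rw [hρ]; field_simp; ring
  have h1ρ' : 1 + ρ = 2 * x₂ / (x₁ + x₂) := by rw [hρ]; field_simp; ring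
  have hquot : (1 + ρ) / (1 - ρ) = x₂ / x₁ := by
    rw [h1ρ, h1ρ']
    field_simp
  set w₁ : ℂ := ((-ρ : ℝ) : ℂ) with hw₁
  have hw₁n : ‖w₁‖ = ρ := by
    rw [hw₁, norm_real, Real.norm_eq_abs, abs_neg, abs_of_nonneg hρ0]
  have hw₁b : w₁ ∈ ball (0 : ℂ) 1 := mem_ball_zero_iff.2 (by rw [hw₁n]; exact hρ1)
  have h0b : (0 : ℂ) ∈ ball (0 : ℂ) 1 := mem_ball_self one_pos
  have hψ0 : ψ 0 = (x₂ : ℂ) := by simp [hψ]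
  have hψ1 : ψ w₁ = (x₁ : ℂ) := by
    have h1 : (1 : ℂ) + w₁ = ((2 * x₁ / (x₁ + x₂) : ℝ) : ℂ) := by
      rw [← h1ρ, hw₁]; push_cast; ring
    have h2 : (1 : ℂ) - w₁ = ((2 * x₂ / (x₁ + x₂) : ℝ) : ℂ) := by
      rw [← h1ρ', hw₁]; push_cast; ring
    show (x₂ : ℂ) * ((1 + w₁) / (1 - w₁)) = (x₁ : ℂ)
    rw [h1, h2]
    norm_cast
    field_simp
  -- the UPPER Harnack bound on the unit disc for `Q = (F + ε) I`
  have hchord : ∀ ε : ℝ, 0 < ε → v x₁ + ε ≤ (v x₂ + ε) * ((1 + ρ) / (1 - ρ)) := by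
    intro ε hε
    set Q : ℂ → ℂ := fun w ↦ (F w + ε) * I with hQ
    have hQim : ∀ w ∈ ball (0 : ℂ) 1, (Q w).im = v (ψ w) + ε := by
      intro w hw
      have e : (F w).re = v (ψ w) := hFre hw
      show ((F w + ε) * I).im = v (ψ w) + ε
      rw [mul_I_im, add_re, ofReal_re, e]
    have hQd : DifferentiableOn ℂ Q (ball 0 1) :=
      (hFa.differentiableOn.add_const _).mul_const _
    have hQpos : ∀ w ∈ ball (0 : ℂ) 1, 0 < (Q w).im := by
      intro w hw
      rw [hQim w hw]
      exact add_pos_of_nonneg_of_pos (hv0 _ (hψre w hw)) hε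
    have h := Complex.im_apply_le_harnack one_pos hQd hQpos hw₁b
    rw [sub_zero, hw₁n, hQim 0 h0b, hQim w₁ hw₁b, hψ0, hψ1] at h
    exact h
  -- `ε → 0⁺`, then multiply by `x₁ > 0`
  rw [hquot] at hchord
  have hle : v x₁ ≤ v x₂ * (x₂ / x₁) := by
    refine le_of_forall_pos_le_add fun ε hε ↦ ?_
    have h := hchord (ε * (x₁ / (x₁ + x₂))) (by positivity)
    -- `(v x₂ + ε')·(x₂/x₁) - ε' = v x₂·(x₂/x₁) + ε'·(x₂ - x₁)/x₁ ≤ v x₂·(x₂/x₁) + ε`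
    have key : (v x₂ + ε * (x₁ / (x₁ + x₂))) * (x₂ / x₁) - ε * (x₁ / (x₁ + x₂)) ≤
        v x₂ * (x₂ / x₁) + ε := by
      have e1 : (v x₂ + ε * (x₁ / (x₁ + x₂))) * (x₂ / x₁) - ε * (x₁ / (x₁ + x₂))
          = v x₂ * (x₂ / x₁) + ε * ((x₂ - x₁) / (x₁ + x₂)) := by
        field_simp
        ring
      rw [e1]
      have e2 : (x₂ - x₁) / (x₁ + x₂) ≤ 1 := by
        rw [div_le_one hs]; linarith
      nlinarith
    linarith
  have := mul_le_mul_of_nonneg_left hle hx₁.le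
  calc x₁ * v x₁ ≤ x₁ * (v x₂ * (x₂ / x₁)) := this
    _ = x₂ * v x₂ := by field_simp

end Literature.Analysis.Complex

end
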